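import Summits.KontsevichZagierPeriods.KontsevichZagierPeriods.Theorems.RootDecompQuadraticDescentEulerReflection
import Summits.KontsevichZagierPeriods.KontsevichZagierPeriods.Theorems.RootDecompQuadraticDescentLegendrePairs

/-!
# Euler's reflection `ζ(2) = 2·Li₂(½) + log²2` BY THE MOVES, inside dimension 2 — part 4/4: the census forms — `Lrect` (the half-box representative of `Li₂(½)`), `xEul` / `euler_improper` (in every `R ⊇ relations`), `P`, `W = P × P`, `Zk`, and `xEulPi` / `xEulRect` with `eulerPi_improper` / `eulerRect_improper` (census K17a's literal element lies in every `R ⊇ relations` with `Coinc(R,2)`, spending exactly ONE Basel pair)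

Theorems-split (≤ 400 lines each) of the decomp-kz lens-6 gen-4 file
`run/shared/lean/pub/decomp-kz/decomp-kz-lens-6/g4/RootDecompQuadraticDescentEulerReflection.lean` (1018 lines, critic re-check
2026-08-30T04:40:16Z: rc0, axioms(eulerReflection_byMoves) = {propext, Classical.choice, Quot.sound}); parts:
`…EulerShear` → `…EulerDissect` → `…EulerReflection` → `…EulerCensus`. Support for item stmt-KontsevichZagierPeriods-26540
(QuadraticDescent) and a decided ≥3-term dimension-2 instance for stmt-KontsevichZagierPeriods-4280.
Sources: Euler 1768; L. Lewin, *Polylogarithms and associated functions* (1981) §1.5; D. Zagier, *The dilogarithm function* (2007)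
§I.1–I.2; M. Kontsevich, D. Zagier, *Periods* (2001) §1.1, §1.2 (rules 1a, 1b, 2).
-/

noncomputable section

set_option linter.dupNamespace false

open MeasureTheory Set
open MvPolynomial (aeval X C)
open Literature.ModelTheory.ExponentialFields (IsSemialgebraic tarski_seidenberg_real_holds)

namespace Summit.KontsevichZagierPeriods.KontsevichZagierPeriods.Theorems.RootDecompQuadraticDescentEulerReflection

open Literature.NumberTheory.Transcendental
open Literature.NumberTheory.Transcendental.KZ
open Summit.KontsevichZagierPeriods.KontsevichZagierPeriods.Theorems.RootDecompQuadraticDescentLegendre (isRational_prod)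

/-! #### The census representative of `Li₂(½)`: the half-box `[(0,½)×(0,1), dsdt/(1−st)]` -/

/-- The open half-box `(0,½) × (0,1)`. -/
def Bhalf : Set (Fin 2 → ℝ) := {z | (0 < z 0 ∧ z 0 < 1 / 2) ∧ (0 < z 1 ∧ z 1 < 1)}

/-- `Bhalf` is `ℚ`-semialgebraic. [BCR1998 §2.2] -/
lemma isSemialgebraic_Bhalf : IsSemialgebraic ℚ Bhalf := by
  have h := isSemialgebraic_setOf_forall_aeval_pos
    ![(X 0 : MvPolynomial (Fin 2) ℚ), C (1/2) - X 0, X 1, 1 - X 1]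
  convert h using 1
  ext z
  simp only [Bhalf, mem_setOf_eq, Fin.forall_fin_succ, Matrix.cons_val_zero, Matrix.cons_val_succ, map_sub,
    map_one, MvPolynomial.aeval_X, MvPolynomial.aeval_C, eq_ratCast, sub_pos, IsEmpty.forall_iff, and_true]
  norm_num [and_assoc]

/-- `Bhalf` is measurable. [bookkeeping] -/
lemma measurableSet_Bhalf : MeasurableSet Bhalf := isSemialgebraic_Bhalf.measurableSet_holds

/-- `Bhalf ⊆ Sq`. [bookkeeping] -/
lemma Bhalf_subset_Sq : Bhalf ⊆ Sq := by
  rintro z ⟨⟨h0, h1⟩, h2, h3⟩ j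
  fin_cases j
  · change z 0 ∈ Set.Ioo (0:ℝ) 1
    exact ⟨h0, by linarith⟩
  · exact ⟨h2, h3⟩

/-- `Lrect := [(0,½)×(0,1), dsdt/(1−st)]` — the census's KZ-rational representative of `Li₂(½)`. -/
def Lrect : KZ.IntegralRep 2 :=
  KZ.IntegralRep.ofRational Bhalf 1 (1 - X 0 * X 1) isSemialgebraic_Bhalf
    (fun x hx => by
      have h0 := (Bhalf_subset_Sq hx) 0; have h1 := (Bhalf_subset_Sq hx) 1
      have : x 0 * x 1 < 1 := by nlinarith [h0.1, h0.2, h1.1, h1.2]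
      simp only [map_sub, map_one, map_mul, MvPolynomial.aeval_X]; exact (sub_pos.2 this).ne')
    (by rw [Zsq_aux]; exact box_integral_one_div_one_sub_mul_two.1.mono_set Bhalf_subset_Sq)

/-- `Lrect` is KZ-rational. [bookkeeping] -/
lemma isRational_Lrect : Lrect.IsRational := KZ.IntegralRep.isRational_ofRational _ _ _ _ _ _
/-- The integrand of `Lrect`, unfolded. [bookkeeping] -/
lemma integrand_Lrect : Lrect.integrand = fun x => 1 / (1 - x 0 * x 1) := by
  rw [Lrect, KZ.IntegralRep.integrand_ofRational, Zsq_aux]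

/-- The shear chart on the half-box: `(s,t) ↦ (s,st)` carries `(0,½)×(0,1)` onto `L = {0<y<x<½}`. -/
theorem exists_shearChart_half :
    ∃ (Φ : (Fin 2 → ℝ) → (Fin 2 → ℝ)) (Φ' : (Fin 2 → ℝ) → (Fin 2 → ℝ) →L[ℝ] (Fin 2 → ℝ)),
      (∀ z, Φ z 0 = z 0) ∧ (∀ z, Φ z 1 = z 0 * z 1) ∧
      IsSemialgebraicMapOn ℚ Bhalf Φ ∧ (∀ z, HasFDerivAt Φ (Φ' z) z) ∧ Set.InjOn Φ Bhalf ∧ Φ '' Bhalf = L ∧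
      (∀ z, (Φ' z).det = z 0) := by
  obtain ⟨Φ, Φ', hΦ0, hΦ1, hsa, hderiv, hinj, himage, hdet⟩ := exists_shearChart
  refine ⟨Φ, Φ', hΦ0, hΦ1, hsa.mono Bhalf_subset_Sq isSemialgebraic_Bhalf, hderiv, hinj.mono Bhalf_subset_Sq, ?_,
    hdet⟩
  ext y
  constructor
  · rintro ⟨z, ⟨⟨h0, h1⟩, h2, h3⟩, rfl⟩
    simp only [L, mem_setOf_eq, hΦ0, hΦ1]
    refine ⟨mul_pos h0 h2, ?_, h1⟩
    nlinarith
  · rintro ⟨hy0, hy1, hy2⟩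
    have hx : 0 < y 0 := lt_trans hy0 hy1
    have hq : y 1 / y 0 < 1 := by rw [div_lt_one hx]; exact hy1
    refine ⟨![y 0, y 1 / y 0], ⟨⟨hx, hy2⟩, div_pos hy0 hx, hq⟩, ?_⟩
    funext i
    fin_cases i
    · exact hΦ0 _
    · change Φ ![y 0, y 1 / y 0] 1 = y 1
      rw [hΦ1]
      change y 0 * (y 1 / y 0) = y 1
      field_simp

/-- `[Lrect] − [Ltri] ∈ KZ.relations` (rule 2, the shear restricted to the half-box). -/
theorem Lrect_sub_Ltri_mem : of Lrect - of Ltri ∈ KZ.relations := by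
  obtain ⟨Φ, Φ', hΦ0, hΦ1, hsa, hderiv, hinj, himage, hdet⟩ := exists_shearChart_half
  refine changeOfVariablesRel_subset_relations ⟨2, Lrect, Ltri, Φ, Φ', hsa,
    fun z _ => (hderiv z).hasFDerivWithinAt, hinj, himage.symm, fun z hz => ?_, rfl⟩
  have h0 := (Bhalf_subset_Sq hz) 0; have h1 := (Bhalf_subset_Sq hz) 1
  have hx : (0:ℝ) < z 0 := h0.1
  have hxy : z 0 * z 1 < 1 := by nlinarith [h0.1, h0.2, h1.1, h1.2]
  change Lrect.integrand z = Ttri.integrand (Φ z) * |(Φ' z).det|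
  rw [integrand_Lrect, integrand_Ttri]
  simp only [hdet, hΦ0, hΦ1, abs_of_pos hx]
  field_simp

/-- `value Lrect = Li₂(½) = π²/12 − log²2/2` as well. -/
theorem value_Lrect : Lrect.value = Real.pi ^ 2 / 12 - Real.log 2 ^ 2 / 2 := by
  have h0 := (AddMonoidHom.mem_ker).mp (KZ.relations_le_ker_eval_holds Lrect_sub_Ltri_mem)
  simp only [map_sub, KZ.eval_of, value_Ltri] at h0
  linarith

/-! ### QuadraticDescent(2) commentary: the Euler-reflection element is an IMPROPER input -/

/-- The native Euler-reflection element of the `QuadraticDescent 2` generator closure: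
two `2`-dimensional singles and one product of `1`-dimensional rationals. -/
def xEul : KZ.FormalRep := of Zsq - 2 • of Ltri - of ell * of ell

/-- `xEul` lies in the generator closure of `QuadraticDescent 2` (singles of dimension `≤ 2`,
products `a + b ≤ 3`). -/
theorem xEul_mem_closure :
    xEul ∈ AddSubgroup.closure
      ({y : KZ.FormalRep | ∃ (a b : ℕ) (s : KZ.IntegralRep a) (t : KZ.IntegralRep b),
          a ≤ 2 ∧ b ≤ 2 ∧ a + b ≤ 2 + 1 ∧ s.IsRational ∧ t.IsRational ∧ y = KZ.of s * KZ.of t} ∪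
        {y : KZ.FormalRep | ∃ (k : ℕ) (u : KZ.IntegralRep k), k ≤ 2 ∧ u.IsRational ∧ y = KZ.of u}) := by
  unfold xEul
  refine AddSubgroup.sub_mem _ (AddSubgroup.sub_mem _ ?_ (AddSubgroup.nsmul_mem _ ?_ 2)) ?_
  · exact AddSubgroup.subset_closure (Set.mem_union_right _ ⟨2, Zsq, le_rfl, isRational_Zsq, rfl⟩)
  · exact AddSubgroup.subset_closure (Set.mem_union_right _ ⟨2, Ltri, le_rfl, isRational_Ltri, rfl⟩)
  · exact AddSubgroup.subset_closure
      (Set.mem_union_left _ ⟨1, 1, ell, ell, by norm_num, by norm_num, by norm_num, isRational_ell,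
        isRational_ell, rfl⟩)

/-- `eval xEul = 0` (UNCONDITIONAL: it is a relation). -/
theorem eval_xEul : KZ.eval xEul = 0 :=
  (AddMonoidHom.mem_ker).mp (KZ.relations_le_ker_eval_holds eulerReflection_byMoves)

/-- **IMPROPER (native form).** The value-`0` closure element `xEul` lies in every `R ⊇ KZ.relations` —
with NO coincidence hypothesis at all: Euler's reflection is a relation by the moves. -/
theorem euler_improper (R : AddSubgroup KZ.FormalRep) (hR : KZ.relations ≤ R) : xEul ∈ R :=
  hR eulerReflection_byMoves

/-! #### The census form `12·Li₂(½) = π² − 6·log²2` (one `Coinc(R,2)` pair: Basel `6ζ(2) = π²`) -/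

/-- The open unit interval in `ℝ¹`. -/
def I1 : Set (Fin 1 → ℝ) := {t | t 0 ∈ Set.Ioo (0:ℝ) 1}

/-- `I1` is `ℚ`-semialgebraic. [BCR1998 §2.2] -/
lemma isSemialgebraic_I1 : IsSemialgebraic ℚ I1 := by
  convert KZ.isSemialgebraic_box 1 using 1
  ext x
  simp [I1, Fin.forall_fin_one]

/-- `I1` is measurable. [bookkeeping] -/
lemma measurableSet_I1 : MeasurableSet I1 :=
  measurableSet_Ioo.preimage (measurable_pi_apply 0)

/-- Integrability on the relevant piece (`integrableOn_I1_of`). [bookkeeping] -/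
lemma integrableOn_I1_of {f : ℝ → ℝ} (hf : IntegrableOn f (Set.Ioo (0:ℝ) 1)) :
    IntegrableOn (fun t : Fin 1 → ℝ => f (t 0)) I1 :=
  ((volume_preserving_funUnique (Fin 1) ℝ).integrableOn_comp_preimage
      (MeasurableEquiv.funUnique (Fin 1) ℝ).measurableEmbedding).2 hf

/-- Set integral over `I1` rewritten in one variable. [bookkeeping] -/
lemma setIntegral_I1 (f : ℝ → ℝ) :
    ∫ t in I1, f (t 0) = ∫ x in Set.Ioo (0:ℝ) 1, f x :=
  (volume_preserving_funUnique (Fin 1) ℝ).setIntegral_preimage_emb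
    (MeasurableEquiv.funUnique (Fin 1) ℝ).measurableEmbedding f (Set.Ioo (0:ℝ) 1)

/-- `P := [(0,1), 4/(1+u²)]` — KZ-rational, dimension `1`, value `π`. -/
def P : KZ.IntegralRep 1 :=
  KZ.IntegralRep.ofRational I1 (C 4) (1 + X 0 ^ 2) isSemialgebraic_I1
    (fun x _ => by simp; positivity)
    (by
      have hc4 : Continuous (fun u : ℝ => 4 / (1 + u ^ 2)) :=
        Continuous.div continuous_const (by fun_prop) fun u => by positivity
      have h : IntegrableOn (fun t : Fin 1 → ℝ => (fun u : ℝ => 4 / (1 + u ^ 2)) (t 0)) I1 :=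
        integrableOn_I1_of (f := fun u : ℝ => 4 / (1 + u ^ 2))
          ((hc4.integrableOn_Icc (a := 0) (b := 1)).mono_set Set.Ioo_subset_Icc_self)
      refine h.congr_fun (fun t _ => ?_) measurableSet_I1
      simp)

/-- `P` is KZ-rational. [bookkeeping] -/
lemma isRational_P : P.IsRational := KZ.IntegralRep.isRational_ofRational _ _ _ _ _ _

/-- The value of `P`. [bookkeeping] -/
lemma value_P : P.value = Real.pi := by
  have integral_four_div : ∫ x in Set.Ioo (0:ℝ) 1, 4 / (1 + x ^ 2) = Real.pi := by
    rw [← integral_Ioc_eq_integral_Ioo, ← intervalIntegral.integral_of_le zero_le_one]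
    have h := integral_inv_one_add_sq (a := (0:ℝ)) (b := 1)
    have e : (fun x : ℝ => 4 / (1 + x ^ 2)) = fun x => 4 * (1 + x ^ 2)⁻¹ := by
      funext x; rw [div_eq_mul_inv]
    rw [e, intervalIntegral.integral_const_mul, h, Real.arctan_one, Real.arctan_zero]
    ring
  rw [P, KZ.IntegralRep.value_ofRational, ← integral_four_div, ← setIntegral_I1]
  refine setIntegral_congr_fun measurableSet_I1 fun t _ => ?_
  simp

/-- `W := P × P` — KZ-rational, dimension `2`, value `π²`. -/
def W : KZ.IntegralRep 2 := P.prod P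

/-- `W` is KZ-rational. [bookkeeping] -/
lemma isRational_W : W.IsRational := isRational_prod isRational_P isRational_P

/-- The value of `W`. [bookkeeping] -/
lemma value_W : W.value = Real.pi ^ 2 := by
  change (P.prod P).value = _
  rw [KZ.IntegralRep.value_prod, value_P, sq]

/-- Auxiliary step `of_P_mul_of_P`. [bookkeeping] -/
lemma of_P_mul_of_P : of P * of P = of W := by
  rw [of_mul_of]; rfl

/-- `Zk k := [(0,1)², k/(1−xy)]` (value `k·ζ(2)`). -/
lemma Zk_aux (k : ℕ) : (fun x : Fin 2 → ℝ => aeval x (C (k : ℚ) : MvPolynomial (Fin 2) ℚ) /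
    aeval x (1 - X 0 * X 1 : MvPolynomial (Fin 2) ℚ)) = fun x => (k : ℝ) * (1 / (1 - x 0 * x 1)) := by
  funext x; simp [div_eq_mul_inv]

/-- Auxiliary step `Zk`. [bookkeeping] -/
def Zk (k : ℕ) : KZ.IntegralRep 2 :=
  KZ.IntegralRep.ofRational Sq (C (k : ℚ)) (1 - X 0 * X 1) isSemialgebraic_Sq
    (fun x hx => by
      have h0 := hx 0; have h1 := hx 1
      have : x 0 * x 1 < 1 := by nlinarith [h0.1, h0.2, h1.1, h1.2]
      simp only [map_sub, map_one, map_mul, MvPolynomial.aeval_X]; exact (sub_pos.2 this).ne')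
    (by rw [Zk_aux]; exact box_integral_one_div_one_sub_mul_two.1.const_mul _)

/-- `Zk` is KZ-rational. [bookkeeping] -/
lemma isRational_Zk (k : ℕ) : (Zk k).IsRational := KZ.IntegralRep.isRational_ofRational _ _ _ _ _ _
/-- The domain of `Zk`, by definition. [bookkeeping] -/
lemma domain_Zk (k : ℕ) : (Zk k).domain = Sq := rfl
/-- The integrand of `Zk`, unfolded. [bookkeeping] -/
lemma integrand_Zk (k : ℕ) : (Zk k).integrand = fun x => (k : ℝ) * (1 / (1 - x 0 * x 1)) := by
  rw [Zk, KZ.IntegralRep.integrand_ofRational, Zk_aux]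

/-- The value of `Zk`. [bookkeeping] -/
theorem value_Zk (k : ℕ) : (Zk k).value = k * (Real.pi ^ 2 / 6) := by
  rw [KZ.IntegralRep.value, integrand_Zk]
  change ∫ x in Sq, (k : ℝ) * (1 / (1 - x 0 * x 1)) = _
  rw [integral_const_mul]
  exact congrArg _ box_integral_one_div_one_sub_mul_two.2

/-- `[Z_{k+1}] − [Z_k] − [Zsq] ∈ KZ.relations` (rule 1b, additivity in the integrand). -/
lemma Zk_succ_mem (k : ℕ) : of (Zk (k + 1)) - of (Zk k) - of Zsq ∈ KZ.relations := by
  refine integrandAddRel_subset_relations ⟨2, Zk (k + 1), Zk k, Zsq,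
    (domain_Zk k).trans (domain_Zk (k + 1)).symm, domain_Zsq.trans (domain_Zk (k + 1)).symm,
    fun x _ => ?_, rfl⟩
  simp only [Pi.add_apply, integrand_Zk, integrand_Zsq, Nat.cast_add, Nat.cast_one]
  ring

/-- `[Z_k] − k·[Zsq] ∈ KZ.relations`. -/
theorem Zk_sub_nsmul_mem : ∀ k : ℕ, 1 ≤ k → of (Zk k) - k • of Zsq ∈ KZ.relations
  | 0, h => absurd h (by norm_num)
  | 1, _ => by
      rw [one_nsmul]
      refine KZ.of_sub_of_mem_relations_of_eqOn (domain_Zsq.trans (domain_Zk 1).symm) fun x _ => ?_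
      simp only [integrand_Zk, integrand_Zsq, Nat.cast_one, one_mul]
  | (k + 2), _ => by
      have ih := Zk_sub_nsmul_mem (k + 1) (by omega)
      have hs := Zk_succ_mem (k + 1)
      have e : of (Zk (k + 2)) - (k + 2) • of Zsq =
          (of (Zk (k + 1 + 1)) - of (Zk (k + 1)) - of Zsq) + (of (Zk (k + 1)) - (k + 1) • of Zsq) := by
        simp only [add_nsmul, one_nsmul]; abel
      rw [e]
      exact add_mem hs ih

/-- The census form of the Euler-reflection element: `[P]·[P] − 6·[ell]·[ell] − 12·[Ltri]`
(`π² − 6 log²2 − 12 Li₂(½) = 0`). -/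
def xEulPi : KZ.FormalRep := of P * of P - 6 • (of ell * of ell) - 12 • of Ltri

/-- Auxiliary step `xEulPi_mem_closure`. [bookkeeping] -/
theorem xEulPi_mem_closure :
    xEulPi ∈ AddSubgroup.closure
      ({y : KZ.FormalRep | ∃ (a b : ℕ) (s : KZ.IntegralRep a) (t : KZ.IntegralRep b),
          a ≤ 2 ∧ b ≤ 2 ∧ a + b ≤ 2 + 1 ∧ s.IsRational ∧ t.IsRational ∧ y = KZ.of s * KZ.of t} ∪
        {y : KZ.FormalRep | ∃ (k : ℕ) (u : KZ.IntegralRep k), k ≤ 2 ∧ u.IsRational ∧ y = KZ.of u}) := by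
  unfold xEulPi
  refine AddSubgroup.sub_mem _ (AddSubgroup.sub_mem _ ?_ (AddSubgroup.nsmul_mem _ ?_ 6))
    (AddSubgroup.nsmul_mem _ ?_ 12)
  · exact AddSubgroup.subset_closure
      (Set.mem_union_left _ ⟨1, 1, P, P, by norm_num, by norm_num, by norm_num, isRational_P,
        isRational_P, rfl⟩)
  · exact AddSubgroup.subset_closure
      (Set.mem_union_left _ ⟨1, 1, ell, ell, by norm_num, by norm_num, by norm_num, isRational_ell,
        isRational_ell, rfl⟩)
  · exact AddSubgroup.subset_closure (Set.mem_union_right _ ⟨2, Ltri, le_rfl, isRational_Ltri, rfl⟩)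

/-- Auxiliary step `eval_xEulPi`. [bookkeeping] -/
theorem eval_xEulPi : KZ.eval xEulPi = 0 := by
  simp only [xEulPi, map_sub, map_nsmul, KZ.eval_mul', KZ.eval_of, value_P, value_ell, value_Ltri,
    nsmul_eq_mul, Nat.cast_ofNat]
  ring

/-- **IMPROPER (census form).** For every `R ⊇ KZ.relations`, two-sided ideal, with `Coinc(R,2)`
(the hypotheses of `QuadraticDescent 2`, no appeal to the piece), `xEulPi ∈ R`: the ONE coincidence
used is the Basel pair `([P × P], [Z₆])` (`π² = 6ζ(2)`, both KZ-rational of dimension `2`); the rest is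
`6·xEul ∈ KZ.relations` and the integrand scaling `[Z₆] − 6[Zsq] ∈ KZ.relations`. -/
theorem eulerPi_improper (R : AddSubgroup KZ.FormalRep) (hR : KZ.relations ≤ R)
    (hC : ∀ ⦃n m : ℕ⦄, n ≤ 2 → m ≤ 2 → ∀ (r : KZ.IntegralRep n) (r' : KZ.IntegralRep m),
      r.IsRational → r'.IsRational → r.value = r'.value → KZ.of r - KZ.of r' ∈ R) :
    xEulPi ∈ R := by
  have h1 : of W - of (Zk 6) ∈ R :=
    hC le_rfl le_rfl W (Zk 6) isRational_W (isRational_Zk 6) (by rw [value_W, value_Zk]; push_cast; ring)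
  have h2 : of (Zk 6) - 6 • of Zsq ∈ R := hR (Zk_sub_nsmul_mem 6 (by norm_num))
  have h3 : 6 • xEul ∈ R := R.nsmul_mem (hR eulerReflection_byMoves) 6
  have e : xEulPi = (of W - of (Zk 6)) + (of (Zk 6) - 6 • of Zsq) + 6 • xEul := by
    rw [xEulPi, xEul, of_P_mul_of_P, nsmul_sub, nsmul_sub, smul_smul]; abel
  rw [e]
  exact add_mem (add_mem h1 h2) h3

/-- The census's literal element (row K17a): `[P]·[P] − 6·[ell]·[ell] − 12·[Lrect]`. -/
def xEulRect : KZ.FormalRep := of P * of P - 6 • (of ell * of ell) - 12 • of Lrect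

/-- Auxiliary step `xEulRect_mem_closure`. [bookkeeping] -/
theorem xEulRect_mem_closure :
    xEulRect ∈ AddSubgroup.closure
      ({y : KZ.FormalRep | ∃ (a b : ℕ) (s : KZ.IntegralRep a) (t : KZ.IntegralRep b),
          a ≤ 2 ∧ b ≤ 2 ∧ a + b ≤ 2 + 1 ∧ s.IsRational ∧ t.IsRational ∧ y = KZ.of s * KZ.of t} ∪
        {y : KZ.FormalRep | ∃ (k : ℕ) (u : KZ.IntegralRep k), k ≤ 2 ∧ u.IsRational ∧ y = KZ.of u}) := by
  unfold xEulRect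
  refine AddSubgroup.sub_mem _ (AddSubgroup.sub_mem _ ?_ (AddSubgroup.nsmul_mem _ ?_ 6))
    (AddSubgroup.nsmul_mem _ ?_ 12)
  · exact AddSubgroup.subset_closure
      (Set.mem_union_left _ ⟨1, 1, P, P, by norm_num, by norm_num, by norm_num, isRational_P,
        isRational_P, rfl⟩)
  · exact AddSubgroup.subset_closure
      (Set.mem_union_left _ ⟨1, 1, ell, ell, by norm_num, by norm_num, by norm_num, isRational_ell,
        isRational_ell, rfl⟩)
  · exact AddSubgroup.subset_closure (Set.mem_union_right _ ⟨2, Lrect, le_rfl, isRational_Lrect, rfl⟩)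

/-- Auxiliary step `eval_xEulRect`. [bookkeeping] -/
theorem eval_xEulRect : KZ.eval xEulRect = 0 := by
  simp only [xEulRect, map_sub, map_nsmul, KZ.eval_mul', KZ.eval_of, value_P, value_ell, value_Lrect,
    nsmul_eq_mul, Nat.cast_ofNat]
  ring

/-- **IMPROPER (census's literal element).** Same verdict for the half-box representative. -/
theorem eulerRect_improper (R : AddSubgroup KZ.FormalRep) (hR : KZ.relations ≤ R)
    (hC : ∀ ⦃n m : ℕ⦄, n ≤ 2 → m ≤ 2 → ∀ (r : KZ.IntegralRep n) (r' : KZ.IntegralRep m),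
      r.IsRational → r'.IsRational → r.value = r'.value → KZ.of r - KZ.of r' ∈ R) :
    xEulRect ∈ R := by
  have h1 : xEulPi ∈ R := eulerPi_improper R hR hC
  have h2 : 12 • (of Lrect - of Ltri) ∈ R := R.nsmul_mem (hR Lrect_sub_Ltri_mem) 12
  have e : xEulRect = xEulPi - 12 • (of Lrect - of Ltri) := by
    rw [xEulRect, xEulPi, nsmul_sub]; abel
  rw [e]
  exact sub_mem h1 h2

end Summit.KontsevichZagierPeriods.KontsevichZagierPeriods.Theorems.RootDecompQuadraticDescentEulerReflection
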